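import Summits.HodgeConjecture.HodgeConjecture.Theorems.SecondaryPeriodsLevelOneConiveauThreefoldsCurveCorrespondences
import Literature.AlgebraicGeometry.HodgeTheory.LevelOneSubHodgeStructuresOfCurvesRankTwo
import Literature.Barriers.HodgeConjecture.DecompositionOfTheDiagonal
import Literature.AlgebraicGeometry.HodgeTheory.WeightOneHodgeStructuresCurveSections

/-!
# `LevelOneConiveauThreefolds` (route `SecondaryPeriods`, crux stmt-HodgeConjecture-10376):
# the curve-correspondence line in RANK TWO — the attractor-plane regime, unconditionally

Sequel of `Theorems/SecondaryPeriodsLevelOneConiveauThreefoldsCurveCorrespondences`. The route's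
habitat is a rank-two rational level-one sub-Hodge structure `V ≅ H¹(E)(−1) ⊂ H³(Y, ℚ)` of a
K3-fibred Calabi–Yau threefold at a rational rank-two attractor point (CandelasEtAl2020 §6,
BonischEtAl2024 §3.3). In rank two STUB 1 of the line (`stub_levelOneSpanOfCurve`: the level-one
structure is `φ(H¹(C(ℂ)))` for a smooth projective curve `C` and a rational type-`(1,1)` map `φ`)
holds UNCONDITIONALLY in the tree: Riemann's theorem in rank two is the landed
`weightOne_polarizable_eq_range_of_curve_of_finrank_eq_two` (one-dimensional polarised tori are
elliptic curves by uniformisation), fed through the rank-local reduction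
`exists_curve_of_levelOne_threefold_span_of_finrank_eq_two`
(`Literature/…/LevelOneSubHodgeStructuresOfCurvesRankTwo`). Consequences recorded here:

* `levelOneSpanOfCurve_of_finrank_eq_two` — STUB 1 for `dim_ℂ W = 2`, no hypothesis;
* `span_le_supportedClasses_of_finrank_eq_two_of_curveCorrespondences` — GHC(3,1) for the rank-two
  level-one sub-Hodge structures of `H³` of ONE threefold `Y` from STUB 2 at `Y` alone (algebraicity
  of the level-one curve correspondences into `H³(Y)`);
* `span_le_supportedClasses_of_finrank_eq_two_of_hodgeConjectureFor` — the same from the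
  codimension-2 clause of the Hodge conjecture for the fourfolds `Y ⊗ C`, `C` a smooth projective
  curve: **in the attractor-plane regime, "HC for `Y × E` forces `V ⊂ N¹H³(Y)`" (Grothendieck 1969)
  is now a theorem of the tree with NO Riemann hypothesis**;
* `levelOneConiveauThreefolds_finrankTwo_of_hodgeConjecture` — the rank-two case of the crux from
  the summit, unconditionally (compare `HodgeImpliesConiveauOne`, stmt-HodgeConjecture-3541, proved
  only modulo Riemann's theorem in `Theorems/SecondaryPeriodsHodgeImpliesConiveauOne{,Geometric}`);
* `not_hodgeConjecture_of_coniveauOneFailure_finrankTwo` — contrapositive for the negative side of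
  the route: a RANK-TWO witness of `ConiveauOneFailure` (a smooth projective threefold with a
  rational level-one plane `W ⊂ H³`, `dim W = 2`, not supported on a divisor — exactly the intended
  attractor witness) refutes the Hodge conjecture with no further input (the route's deciding
  theorem `closes` needs the crux `RiemannWeightOne` only for witnesses of higher rank);
* STUB 1 from the route's own crux `RiemannWeightOne` (stmt-HodgeConjecture-16406 = the named fact
  `weightOne_polarizable_eq_range_of_smoothProjective`, Riemann's theorem in GEOMETRIC form): the
  curve form of Riemann's theorem is now reduced in the tree to the geometric form
  (`weightOne_polarizable_eq_range_of_curve_of_geometric`, curve sections + semisimplicity), so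
  `levelOneSpanOfCurve_of_riemannWeightOne : RiemannWeightOne → STUB 1` and
  `levelOneConiveauThreefolds_of_riemannWeightOne_of_curveCorrespondences : RiemannWeightOne → STUB 2 → crux`;
* the KNOWN REGIME of STUB 2 (`curveCorrespondenceAlgebraic_of_blochSrinivas` and corollaries): by
  Bloch–Srinivas 1983 / Voisin II Prop. 10.26 (the catalogued named fact
  `Literature.Barriers.HodgeConjecture.BlochSrinivas1983_hodgeConjectureDegreeFour_of_chowZeroSupported`)
  rational `(2,2)`-classes on a fourfold whose `CH₀` is supported in dimension `≤ 3` are algebraic,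
  so STUB 2 holds at every `(Y, C)` with `CH₀(Y × C)` supported in dimension `≤ 3` (e.g. `Y`
  uniruled), and GHC(3,1) follows for such `Y` in rank two (resp. in all ranks granted Riemann).
-/

noncomputable section

-- `Summit.HodgeConjecture.HodgeConjecture.Theorems` is the mandated namespace (single-conjunct summit:
-- Sub = Summit), which `linter.dupNamespace` flags on every declaration; the lakefile turns the
-- linter off tree-wide (weak option), restated here so stand-alone elaboration is warning-free too.
set_option linter.dupNamespace false

open scoped Manifold
open CategoryTheory AlgebraicGeometry MonoidalCategory CartesianMonoidalCategory
open Literature.AlgebraicTopology.SingularHomology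
open Literature.AlgebraicGeometry Literature.AlgebraicGeometry.Motives
open Literature.AlgebraicGeometry.HodgeTheory

namespace Summit.HodgeConjecture.HodgeConjecture.Theorems

/-! ### STUB 1 in rank two, unconditionally -/

/-- **STUB 1 (`stub_levelOneSpanOfCurve`) in rank two, unconditionally.** For a smooth projective
threefold `Y`, a Hodge model `A` and a finite set `s` of rational classes of `H³(Y(ℂ); ℂ)` whose
span `W` is sub-Hodge, of Hodge coniveau `≥ 1` and of dimension `2`, `W = φ(H¹(C(ℂ); ℂ))` for a
smooth projective curve `C` (an elliptic curve), a Hodge model `B` and a rational map `φ` of type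
`(1,1)`. [cite: VoisinHodgeI2002, §7.2.2 and §7.3.1 Lemma 7.26]
[cite: KerrPearlstein2016, Ch. 11 (Abdulali) §1 p. 288] [cite: SilvermanAEC2009, VI Prop. 3.6 (b)] -/
theorem levelOneSpanOfCurve_of_finrank_eq_two ⦃Y : SchemeOver ℂ⦄ (hY : IsSmoothProjective 3 Y)
    (A : HodgeModel 3 Y) (s : Finset (complexBetti Y 3)) (hs : ∀ c ∈ s, IsRationalClass c)
    (hs2 : Module.finrank ℂ (Submodule.span ℂ (↑s : Set (complexBetti Y 3))) = 2)
    (hsub : (Submodule.span ℂ (↑s : Set (complexBetti Y 3))).map (A.pullback 3).hom =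
      ⨆ (p : ℕ) (q : ℕ) (_ : p + q = 3),
        (Submodule.span ℂ (↑s : Set (complexBetti Y 3))).map (A.pullback 3).hom ⊓ A.hodgePQ 3 p q)
    (hlev : (Submodule.span ℂ (↑s : Set (complexBetti Y 3))).map (A.pullback 3).hom ≤
      ⨆ (p : ℕ) (q : ℕ) (_ : p + q = 3) (_ : 1 ≤ p) (_ : 1 ≤ q), A.hodgePQ 3 p q) :
    ∃ (C : SchemeOver ℂ) (_ : IsSmoothProjective 1 C) (B : HodgeModel 1 C)
      (φ : complexBetti C 1 →ₗ[ℂ] complexBetti Y 3),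
      (∀ c, IsRationalClass c → IsRationalClass (φ c)) ∧
      (∀ (p q : ℕ), p + q = 1 → ∀ c, B.pullback 1 c ∈ B.hodgePQ 1 p q →
        A.pullback 3 (φ c) ∈ A.hodgePQ 3 (p + 1) (q + 1)) ∧
      LinearMap.range φ = Submodule.span ℂ (↑s : Set (complexBetti Y 3)) :=
  exists_curve_of_levelOne_threefold_span_of_finrank_eq_two hY A s hs hs2 hsub hlev

/-! ### STUB 1 from the route's crux `RiemannWeightOne` (all ranks) -/

/-- **STUB 1 from `RiemannWeightOne`** (stmt-HodgeConjecture-16406, Riemann's theorem in geometric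
form = `weightOne_polarizable_eq_range_of_smoothProjective`): the curve form follows from the
geometric form in the tree (`weightOne_polarizable_eq_range_of_curve_of_geometric`: smooth curve
sections injective on `H¹` by the Lefschetz hyperplane theorem, split by the semisimplicity of
polarisable Hodge structures), and STUB 1 follows from the curve form
(`levelOneSpanOfCurve_of_weightOne_curve`). So STUB 1 of the line is closed modulo the route's own
crux #6. [cite: KerrPearlstein2016, Ch. 11 (Abdulali) §1 p. 288] [cite: VoisinHodgeI2002, §7.2.2 and §7.3.1 Lemma 7.26]
[cite: VoisinHodgeII2003, §1.2.2 Thm. 1.23 and §2.1.1] -/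
theorem levelOneSpanOfCurve_of_riemannWeightOne (h : Theses.SecondaryPeriods.RiemannWeightOne)
    ⦃Y : SchemeOver ℂ⦄ (hY : IsSmoothProjective 3 Y) (A : HodgeModel 3 Y)
    (s : Finset (complexBetti Y 3)) (hs : ∀ c ∈ s, IsRationalClass c)
    (hsub : (Submodule.span ℂ (↑s : Set (complexBetti Y 3))).map (A.pullback 3).hom =
      ⨆ (p : ℕ) (q : ℕ) (_ : p + q = 3),
        (Submodule.span ℂ (↑s : Set (complexBetti Y 3))).map (A.pullback 3).hom ⊓ A.hodgePQ 3 p q)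
    (hlev : (Submodule.span ℂ (↑s : Set (complexBetti Y 3))).map (A.pullback 3).hom ≤
      ⨆ (p : ℕ) (q : ℕ) (_ : p + q = 3) (_ : 1 ≤ p) (_ : 1 ≤ q), A.hodgePQ 3 p q) :
    ∃ (C : SchemeOver ℂ) (_ : IsSmoothProjective 1 C) (B : HodgeModel 1 C)
      (φ : complexBetti C 1 →ₗ[ℂ] complexBetti Y 3),
      (∀ c, IsRationalClass c → IsRationalClass (φ c)) ∧
      (∀ (p q : ℕ), p + q = 1 → ∀ c, B.pullback 1 c ∈ B.hodgePQ 1 p q →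
        A.pullback 3 (φ c) ∈ A.hodgePQ 3 (p + 1) (q + 1)) ∧
      LinearMap.range φ = Submodule.span ℂ (↑s : Set (complexBetti Y 3)) :=
  levelOneSpanOfCurve_of_weightOne_curve (weightOne_polarizable_eq_range_of_curve_of_geometric h)
    hY A s hs hsub hlev

/-- **The crux modulo {`RiemannWeightOne`, STUB 2}**: GHC(3,1) for smooth projective threefolds
follows from the route's crux #6 (Riemann's theorem, geometric form, stmt-HodgeConjecture-16406) and
the algebraicity of the level-one curve correspondences into `H³` of threefolds (STUB 2 = HC for the
`(3,1)`-Künneth codimension-2 classes on the fourfolds `Y × C`).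
[cite: GrothendieckTopology1969, p. 301] [cite: KerrPearlstein2016, Ch. 11 (Abdulali) Prop. 3.2 p. 291] -/
theorem levelOneConiveauThreefolds_of_riemannWeightOne_of_curveCorrespondences
    (h : Theses.SecondaryPeriods.RiemannWeightOne)
    (h2 : ∀ ⦃Y C : SchemeOver ℂ⦄ (hY : IsSmoothProjective 3 Y) (hC : IsSmoothProjective 1 C)
      (A : HodgeModel 3 Y) (B : HodgeModel 1 C) (φ : complexBetti C 1 →ₗ[ℂ] complexBetti Y 3),
      (∀ c, IsRationalClass c → IsRationalClass (φ c)) →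
      (∀ (p q : ℕ), p + q = 1 → ∀ c, B.pullback 1 c ∈ B.hodgePQ 1 p q →
        A.pullback 3 (φ c) ∈ A.hodgePQ 3 (p + 1) (q + 1)) →
      ∀ (μ : OrientationFamily), ∃ γ ∈ algebraicClasses (Y ⊗ C) 2,
        corrAction μ hY hC (show 1 + 2 * 2 = 3 + 2 * 1 from rfl) γ = φ) :
    Theses.SecondaryPeriods.LevelOneConiveauThreefolds :=
  levelOneConiveauThreefolds_of_curveCorrespondences (levelOneSpanOfCurve_of_riemannWeightOne h) h2

/-! ### GHC(3,1) in rank two for one threefold -/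

/-- **Rank-two GHC(3,1) for ONE threefold `Y` from STUB 2 at `Y`.** If every rational type-`(1,1)`
map `H¹(C(ℂ)) → H³(Y(ℂ))` from a smooth projective curve is the action of an algebraic
codimension-2 class on `Y ⊗ C` (for the orientation family `μ`), then every rationally spanned
level-one sub-Hodge structure of `H³(Y(ℂ); ℂ)` of dimension `2` lies in `N¹H³(Y)` — no Riemann
hypothesis. [cite: GrothendieckTopology1969, p. 301] [cite: KerrPearlstein2016, Ch. 11 (Abdulali) Prop. 3.2 p. 291] -/
theorem span_le_supportedClasses_of_finrank_eq_two_of_curveCorrespondences (μ : OrientationFamily)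
    {Y : SchemeOver ℂ} (hY : IsSmoothProjective 3 Y) (A : HodgeModel 3 Y)
    (h2 : ∀ ⦃C : SchemeOver ℂ⦄ (hC : IsSmoothProjective 1 C) (B : HodgeModel 1 C)
      (φ : complexBetti C 1 →ₗ[ℂ] complexBetti Y 3),
      (∀ c, IsRationalClass c → IsRationalClass (φ c)) →
      (∀ (p q : ℕ), p + q = 1 → ∀ c, B.pullback 1 c ∈ B.hodgePQ 1 p q →
        A.pullback 3 (φ c) ∈ A.hodgePQ 3 (p + 1) (q + 1)) →
      ∃ γ ∈ algebraicClasses (Y ⊗ C) 2,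
        corrAction μ hY hC (show 1 + 2 * 2 = 3 + 2 * 1 from rfl) γ = φ)
    (s : Finset (complexBetti Y 3)) (hs : ∀ c ∈ s, IsRationalClass c)
    (hs2 : Module.finrank ℂ (Submodule.span ℂ (↑s : Set (complexBetti Y 3))) = 2)
    (hsub : (Submodule.span ℂ (↑s : Set (complexBetti Y 3))).map (A.pullback 3).hom =
      ⨆ (p : ℕ) (q : ℕ) (_ : p + q = 3),
        (Submodule.span ℂ (↑s : Set (complexBetti Y 3))).map (A.pullback 3).hom ⊓ A.hodgePQ 3 p q)
    (hlev : (Submodule.span ℂ (↑s : Set (complexBetti Y 3))).map (A.pullback 3).hom ≤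
      ⨆ (p : ℕ) (q : ℕ) (_ : p + q = 3) (_ : 1 ≤ p) (_ : 1 ≤ q), A.hodgePQ 3 p q) :
    Submodule.span ℂ (↑s : Set (complexBetti Y 3)) ≤ supportedClasses Y 3 1 :=
  span_le_supportedClasses_of_curveRealisation μ hY A _
    (levelOneSpanOfCurve_of_finrank_eq_two hY A s hs hs2 hsub hlev) h2

/-- **Rank-two GHC(3,1) for ONE threefold `Y` from the Hodge conjecture in codimension 2 on the
fourfolds `Y ⊗ C`, `C` a smooth projective curve** — Grothendieck's observation "HC for `Y × E`
forces the attractor plane `V ≅ H¹(E)(−1)` into `N¹H³(Y)`", unconditionally: every rationally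
spanned level-one sub-Hodge structure of `H³(Y(ℂ); ℂ)` of dimension `2` lies in `N¹H³(Y)` as soon as
rational `(2,2)`-classes on every `Y ⊗ C` are algebraic. [cite: GrothendieckTopology1969, p. 301]
[cite: KerrPearlstein2016, Ch. 11 (Abdulali) Prop. 3.2 p. 291] [cite: VoisinHodgeI2002, §11.3.3 Lemma 11.41] -/
theorem span_le_supportedClasses_of_finrank_eq_two_of_hodgeConjectureFor {Y : SchemeOver ℂ}
    (hY : IsSmoothProjective 3 Y)
    (hHC : ∀ ⦃C : SchemeOver ℂ⦄, IsSmoothProjective 1 C → ∀ γ : complexBetti (Y ⊗ C) (2 * 2),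
      IsRationalClass γ → IsOfHodgeType (3 + 1) (Y ⊗ C) (2 * 2) 2 2 γ → γ ∈ algebraicClasses (Y ⊗ C) 2)
    (A : HodgeModel 3 Y) (s : Finset (complexBetti Y 3)) (hs : ∀ c ∈ s, IsRationalClass c)
    (hs2 : Module.finrank ℂ (Submodule.span ℂ (↑s : Set (complexBetti Y 3))) = 2)
    (hsub : (Submodule.span ℂ (↑s : Set (complexBetti Y 3))).map (A.pullback 3).hom =
      ⨆ (p : ℕ) (q : ℕ) (_ : p + q = 3),
        (Submodule.span ℂ (↑s : Set (complexBetti Y 3))).map (A.pullback 3).hom ⊓ A.hodgePQ 3 p q)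
    (hlev : (Submodule.span ℂ (↑s : Set (complexBetti Y 3))).map (A.pullback 3).hom ≤
      ⨆ (p : ℕ) (q : ℕ) (_ : p + q = 3) (_ : 1 ≤ p) (_ : 1 ≤ q), A.hodgePQ 3 p q) :
    Submodule.span ℂ (↑s : Set (complexBetti Y 3)) ≤ supportedClasses Y 3 1 := by
  obtain ⟨μ⟩ : Nonempty OrientationFamily :=
    ⟨fun _ _ h ↦ Classical.choice (ComplexPoints.isOrientableOver ℂ h)⟩
  exact span_le_supportedClasses_of_finrank_eq_two_of_curveCorrespondences μ hY A
    (fun C hC B φ hφ hφH ↦ curveCorrespondenceAlgebraic_of_hodgeConjectureFor hY hC (hHC hC) A B φ hφ hφH μ)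
    s hs hs2 hsub hlev

/-! ### The rank-two case of the crux from the summit, and the contrapositive -/

/-- **The rank-two case of `LevelOneConiveauThreefolds` from the Hodge conjecture, unconditionally**
(no Riemann hypothesis; compare `HodgeImpliesConiveauOne`): under HC, every rationally spanned
level-one sub-Hodge structure of dimension `2` of `H³` of a smooth projective threefold is supported
on a divisor. [cite: GrothendieckTopology1969, p. 301] [cite: KerrPearlstein2016, Ch. 11 (Abdulali) Prop. 3.2 p. 291] -/
theorem levelOneConiveauThreefolds_finrankTwo_of_hodgeConjecture (hHC : _root_.HodgeConjecture)
    ⦃Y : SchemeOver ℂ⦄ (hY : IsSmoothProjective 3 Y) (A : HodgeModel 3 Y)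
    (s : Finset (complexBetti Y 3)) (hs : ∀ c ∈ s, IsRationalClass c)
    (hs2 : Module.finrank ℂ (Submodule.span ℂ (↑s : Set (complexBetti Y 3))) = 2)
    (hsub : (Submodule.span ℂ (↑s : Set (complexBetti Y 3))).map (A.pullback 3).hom =
      ⨆ (p : ℕ) (q : ℕ) (_ : p + q = 3),
        (Submodule.span ℂ (↑s : Set (complexBetti Y 3))).map (A.pullback 3).hom ⊓ A.hodgePQ 3 p q)
    (hlev : (Submodule.span ℂ (↑s : Set (complexBetti Y 3))).map (A.pullback 3).hom ≤
      ⨆ (p : ℕ) (q : ℕ) (_ : p + q = 3) (_ : 1 ≤ p) (_ : 1 ≤ q), A.hodgePQ 3 p q) :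
    Submodule.span ℂ (↑s : Set (complexBetti Y 3)) ≤ supportedClasses Y 3 1 :=
  span_le_supportedClasses_of_finrank_eq_two_of_hodgeConjectureFor hY
    (fun _ hC γ hγ hγH ↦ (hHC (IsSmoothProjective.tensor_holds hY hC)).2 2 γ hγ hγH) A s hs hs2 hsub hlev

/-- **Negative side, rank two: an attractor-type witness refutes the Hodge conjecture with no further
input.** If some smooth projective threefold `Y` carries a finite set `s` of rational classes of
`H³(Y(ℂ); ℂ)` whose span is sub-Hodge, of Hodge coniveau `≥ 1`, of dimension `2`, and NOT contained
in `N¹H³(Y)` (a rank-two witness of `ConiveauOneFailure`, e.g. an attractor plane carried by no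
divisor), then the Hodge conjecture fails — by `levelOneConiveauThreefolds_finrankTwo_of_hodgeConjecture`,
contrapositively. [cite: GrothendieckTopology1969, p. 301] [cite: KerrPearlstein2016, Ch. 11 (Abdulali) Prop. 3.2 p. 291] -/
theorem not_hodgeConjecture_of_coniveauOneFailure_finrankTwo
    (h : ∃ (Y : SchemeOver ℂ) (_ : IsSmoothProjective 3 Y) (A : HodgeModel 3 Y)
      (s : Finset (complexBetti Y 3)), (∀ c ∈ s, IsRationalClass c) ∧
      Module.finrank ℂ (Submodule.span ℂ (↑s : Set (complexBetti Y 3))) = 2 ∧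
      (Submodule.span ℂ (↑s : Set (complexBetti Y 3))).map (A.pullback 3).hom =
        (⨆ (p : ℕ) (q : ℕ) (_ : p + q = 3),
          (Submodule.span ℂ (↑s : Set (complexBetti Y 3))).map (A.pullback 3).hom ⊓ A.hodgePQ 3 p q) ∧
      (Submodule.span ℂ (↑s : Set (complexBetti Y 3))).map (A.pullback 3).hom ≤
        (⨆ (p : ℕ) (q : ℕ) (_ : p + q = 3) (_ : 1 ≤ p) (_ : 1 ≤ q), A.hodgePQ 3 p q) ∧
      ¬ Submodule.span ℂ (↑s : Set (complexBetti Y 3)) ≤ supportedClasses Y 3 1) :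
    ¬ _root_.HodgeConjecture := by
  rintro hHC
  obtain ⟨Y, hY, A, s, hs, hs2, hsub, hlev, hnot⟩ := h
  exact hnot (levelOneConiveauThreefolds_finrankTwo_of_hodgeConjecture hHC hY A s hs hs2 hsub hlev)

/-! ### The known regime of STUB 2: `CH₀(Y × C)` supported in dimension `≤ 3` (Bloch–Srinivas) -/

/-- **STUB 2 at `(Y, C)` in the known regime.** If `CH₀` of the fourfold `Y ⊗ C` is supported on a
closed algebraic subset of dimension `≤ 3` (e.g. `Y` uniruled, or `CH₀(Y)` supported on a surface),
then — granted Bloch–Srinivas 1983 / Voisin II Prop. 10.26 in the tree's rendering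
(`BlochSrinivas1983_hodgeConjectureDegreeFour_of_chowZeroSupported`: rational `(2,2)`-classes of
degree `4` on such a variety are algebraic) — every rational type-`(1,1)` map
`H¹(C(ℂ)) → H³(Y(ℂ))` is the action of an algebraic codimension-2 class on `Y ⊗ C`. These are
exactly the known cases of GHC(3,1) recorded on the crux. [cite: VoisinHodgeII2003, Prop. 10.26]
[cite: BlochSrinivas1983] [cite: VoisinHodgeI2002, §11.3.3 Lemma 11.41] -/
theorem curveCorrespondenceAlgebraic_of_blochSrinivas
    (hBS : Literature.Barriers.HodgeConjecture.BlochSrinivas1983_hodgeConjectureDegreeFour_of_chowZeroSupported)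
    {Y C : SchemeOver ℂ} (hY : IsSmoothProjective 3 Y) (hC : IsSmoothProjective 1 C)
    (hCH : Literature.Barriers.HodgeConjecture.HasChowZeroSupportedInDimLE (Y ⊗ C) 3)
    (A : HodgeModel 3 Y) (B : HodgeModel 1 C) (φ : complexBetti C 1 →ₗ[ℂ] complexBetti Y 3)
    (hφ : ∀ c, IsRationalClass c → IsRationalClass (φ c))
    (hφH : ∀ (p q : ℕ), p + q = 1 → ∀ c, B.pullback 1 c ∈ B.hodgePQ 1 p q →
      A.pullback 3 (φ c) ∈ A.hodgePQ 3 (p + 1) (q + 1))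
    (μ : OrientationFamily) :
    ∃ γ ∈ algebraicClasses (Y ⊗ C) 2,
      corrAction μ hY hC (show 1 + 2 * 2 = 3 + 2 * 1 from rfl) γ = φ :=
  curveCorrespondenceAlgebraic_of_hodgeConjectureFor hY hC
    (hBS (IsSmoothProjective.tensor_holds hY hC) hCH) A B φ hφ hφH μ

/-- **Rank-two GHC(3,1) for a threefold `Y` all of whose products with curves have `CH₀` supported
in dimension `≤ 3`**, granted Bloch–Srinivas only (no Riemann hypothesis).
[cite: VoisinHodgeII2003, Prop. 10.26] [cite: BlochSrinivas1983] [cite: GrothendieckTopology1969, p. 301] -/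
theorem span_le_supportedClasses_of_finrank_eq_two_of_blochSrinivas
    (hBS : Literature.Barriers.HodgeConjecture.BlochSrinivas1983_hodgeConjectureDegreeFour_of_chowZeroSupported)
    {Y : SchemeOver ℂ} (hY : IsSmoothProjective 3 Y)
    (hCH : ∀ ⦃C : SchemeOver ℂ⦄, IsSmoothProjective 1 C →
      Literature.Barriers.HodgeConjecture.HasChowZeroSupportedInDimLE (Y ⊗ C) 3)
    (A : HodgeModel 3 Y) (s : Finset (complexBetti Y 3)) (hs : ∀ c ∈ s, IsRationalClass c)
    (hs2 : Module.finrank ℂ (Submodule.span ℂ (↑s : Set (complexBetti Y 3))) = 2)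
    (hsub : (Submodule.span ℂ (↑s : Set (complexBetti Y 3))).map (A.pullback 3).hom =
      ⨆ (p : ℕ) (q : ℕ) (_ : p + q = 3),
        (Submodule.span ℂ (↑s : Set (complexBetti Y 3))).map (A.pullback 3).hom ⊓ A.hodgePQ 3 p q)
    (hlev : (Submodule.span ℂ (↑s : Set (complexBetti Y 3))).map (A.pullback 3).hom ≤
      ⨆ (p : ℕ) (q : ℕ) (_ : p + q = 3) (_ : 1 ≤ p) (_ : 1 ≤ q), A.hodgePQ 3 p q) :
    Submodule.span ℂ (↑s : Set (complexBetti Y 3)) ≤ supportedClasses Y 3 1 :=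
  span_le_supportedClasses_of_finrank_eq_two_of_hodgeConjectureFor hY
    (fun _ hC ↦ hBS (IsSmoothProjective.tensor_holds hY hC) (hCH hC)) A s hs hs2 hsub hlev

/-- **GHC(3,1) in every rank for a threefold `Y` all of whose products with curves have `CH₀`
supported in dimension `≤ 3`**, granted Bloch–Srinivas and Riemann's theorem in curve form — the
known cases of the crux (`Y` uniruled / rationally connected / `CH₀(Y)` supported on a surface).
[cite: VoisinHodgeII2003, Prop. 10.26 and Cor. 10.21] [cite: BlochSrinivas1983]
[cite: GrothendieckTopology1969, p. 301] -/
theorem span_le_supportedClasses_of_weightOne_curve_of_blochSrinivas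
    (h0 : weightOne_polarizable_eq_range_of_curve)
    (hBS : Literature.Barriers.HodgeConjecture.BlochSrinivas1983_hodgeConjectureDegreeFour_of_chowZeroSupported)
    {Y : SchemeOver ℂ} (hY : IsSmoothProjective 3 Y)
    (hCH : ∀ ⦃C : SchemeOver ℂ⦄, IsSmoothProjective 1 C →
      Literature.Barriers.HodgeConjecture.HasChowZeroSupportedInDimLE (Y ⊗ C) 3)
    (A : HodgeModel 3 Y) (s : Finset (complexBetti Y 3)) (hs : ∀ c ∈ s, IsRationalClass c)
    (hsub : (Submodule.span ℂ (↑s : Set (complexBetti Y 3))).map (A.pullback 3).hom =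
      ⨆ (p : ℕ) (q : ℕ) (_ : p + q = 3),
        (Submodule.span ℂ (↑s : Set (complexBetti Y 3))).map (A.pullback 3).hom ⊓ A.hodgePQ 3 p q)
    (hlev : (Submodule.span ℂ (↑s : Set (complexBetti Y 3))).map (A.pullback 3).hom ≤
      ⨆ (p : ℕ) (q : ℕ) (_ : p + q = 3) (_ : 1 ≤ p) (_ : 1 ≤ q), A.hodgePQ 3 p q) :
    Submodule.span ℂ (↑s : Set (complexBetti Y 3)) ≤ supportedClasses Y 3 1 :=
  span_le_supportedClasses_of_weightOne_curve_of_hodgeConjectureFor h0 hY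
    (fun _ hC ↦ hBS (IsSmoothProjective.tensor_holds hY hC) (hCH hC)) A s hs hsub hlev

/-! ### Registered sub-goal of the crux (line `registered`): the rank-two case from the summit, pure-signature form -/

/-- **Registered sub-goal `stub_finrankTwo_of_hodgeConjecture` of crux stmt-HodgeConjecture-10376** (line
`registered`): the Hodge conjecture implies the rank-two case of `LevelOneConiveauThreefolds`, with NO Riemann
hypothesis (proved by `levelOneConiveauThreefolds_finrankTwo_of_hodgeConjecture`).
[cite: GrothendieckTopology1969, p. 301] [cite: KerrPearlstein2016, Ch. 11 (Abdulali) Prop. 3.2 p. 291] -/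
theorem stub_finrankTwo_of_hodgeConjecture : _root_.HodgeConjecture → ∀ ⦃Y : Motives.SchemeOver ℂ⦄, Motives.IsSmoothProjective 3 Y → ∀ (A : HodgeModel 3 Y) (s : Finset (complexBetti Y 3)), (∀ c ∈ s, IsRationalClass c) → Module.finrank ℂ (Submodule.span ℂ (↑s : Set (complexBetti Y 3))) = 2 → (Submodule.span ℂ (↑s : Set (complexBetti Y 3))).map (A.pullback 3).hom = (⨆ (p : ℕ) (q : ℕ) (_ : p + q = 3), (Submodule.span ℂ (↑s : Set (complexBetti Y 3))).map (A.pullback 3).hom ⊓ A.hodgePQ 3 p q) → (Submodule.span ℂ (↑s : Set (complexBetti Y 3))).map (A.pullback 3).hom ≤ (⨆ (p : ℕ) (q : ℕ) (_ : p + q = 3) (_ : 1 ≤ p) (_ : 1 ≤ q), A.hodgePQ 3 p q) → Submodule.span ℂ (↑s : Set (complexBetti Y 3)) ≤ supportedClasses Y 3 1 :=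
  levelOneConiveauThreefolds_finrankTwo_of_hodgeConjecture

end Summit.HodgeConjecture.HodgeConjecture.Theorems

end
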